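import Summits.ABC.StewartYu.NesterenkoZeroEndEll0
import Literature.NumberTheory.Transcendental.PhilipponZeroEstimateMultidegree
import Summits.ABC.StewartYu.MatveevLeverVolume
import HarnessLib

/-!
# Nesterenko 2003, §5.2: the END of the zero-estimate argument (consumer of Prop. 5.1)

Cell topic `Summits/ABC/StewartYu` (cell abc-stewartyu, seat p4); namespace
`Summit.ABC.StewartYu.ZeroEnd` (theorems only; the `ℓ₀` linear algebra is in
`NesterenkoZeroEndEll0.lean`). WP-M3.E of rung A1.M3 (route `PadicPrimesKummerThird`): what the
Gen-3 engines do with the zero estimate `Literature.NumberTheory.Transcendental.Nesterenko2003_prop51`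
(WP-M3.Z; a HYPOTHESIS here) for THEIR data — `Σ = {(x, ξ₁ˣ, …, ξₙˣ) ; x ∈ ℤ, |x| ≤ X}` with
`ξⱼ ∈ ℂˣ` multiplicatively independent, and `𝔚 = {(η₀, η) ; b₁η₁ + ⋯ + bₙηₙ = 0}` (Nesterenko
2003, §5.2, p. 98) — namely the Matveev alternative in STRUCTURAL form, every parameter inequality
being left to the record:

* `sigma_mem_toSubgroup_imp` / `ncard_image_mk_sigma` — Lemma 5.2 WITHOUT the numerics
  (5.9)–(5.11): `Σ ∩ G* = {e}` from multiplicative independence and `dim G* ≤ n` alone, hence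
  `Card((Σ·G*)/G*) = Card Σ = 2X + 1`;
* `zeroEnd` — the consumer: from the hypotheses of Prop. 5.1 for `(Σ, 𝔚)` one gets a basis
  matrix `M` (`r` independent rows) of the character lattice `Φ` of the obstruction group,
  `d₀ ≤ 1`, `d₀ + (n − r) ≤ n`, and EITHER `b ∉ span_ℚ Φ` with
  `binom(S₀ + r + 1 − d₀, r + 1 − d₀) · (2X+1) · 𝓗 ≤ (n+1)! 2ⁿ D₀ D₁⋯Dₙ` (exit A, killed by the
  record: Lemma 5.3) OR `k b = ∑ cᵢ Mᵢ` for some `k ≠ 0` with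
  `binom(S₀ + r − d₀, r − d₀) · (2X+1) · 𝓗 ≤ (n+1)! 2ⁿ D₀ D₁⋯Dₙ` (exits B (`r = n`, Lemma 5.4) and
  C (`1 ≤ r < n`, the sublattice fed to Prop. 2.6)), `𝓗 = GaGm.nesterenkoH n r d₀ M D₀ D`
  (`ℓ₀` from `ell0_add_addDim_eq`);
* `zeroEnd_lever` — exit C composed with the lever `MatveevLever.exists_short_relation_minors`:
  the short vectors `z₁, …, z_r ∈ Φ`, the relation `m₀ b = ∑ mᵢ zᵢ` and
  `∏ ‖zᵢ‖_A ≤ 2^r Γ(r/2+1) √π^{−r} √n^{r} ∑_t |det M_t| ∏_k A_{t k}` ((2.13) + (5.21)).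

Lineage: the QUALITATIVE cousin on the same `G` with the same `ConnAlgSubgroup` bookkeeping is
`Literature.NumberTheory.Transcendental.LinearSubgroupGaGm.linearSubgroup_of_vanishing`
(`LinearSubgroupGaGmEndgame.lean`; `τ = finrank W − finrank (W ⊓ H.tangent)` = `ℓ₀`), and
`ZeroEstStdBridge.lean` has the `Σ`-as-multiples orbit-card lemmas; the present file is the
QUANTITATIVE version keeping `nesterenkoH`'s minors sum explicit.

WHAT THIS IS NOT: no zero estimate (hypothesis `Nesterenko2003_prop51`, WP-M3.Z), no parameter
inequalities ((5.6), (5.8), (5.12), (5.15)–(5.18), (5.22) are the record's), no linear forms.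

## References

* [Nesterenko2003] Yu. V. Nesterenko, *Linear forms in logarithms of rational numbers*, LNM 1819
  (2003), 53–106: §5.2, Lemmas 5.2–5.4, (5.13)–(5.14), (5.21), pp. 98–104.
-/

noncomputable section

namespace Summit.ABC.StewartYu.ZeroEnd

open Matrix Finset Module
open Literature.NumberTheory.Transcendental Literature.NumberTheory.Transcendental.GaGm

/-! ### Lemma 5.2 without numerics: `Σ ∩ G* = {e}` -/

/-- **Lemma 5.2, structural form.** If `ξ₁, …, ξₙ ∈ ℂˣ` are multiplicatively independent and
`G* = 𝔙 × T_Φ` is a connected algebraic subgroup of dimension `≤ n` whose character lattice has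
a basis of `r` rows, then `(x, ξ₁ˣ, …, ξₙˣ) ∈ G*` forces `x = 0` (the torus condition kills `Φ`
unless `x = 0`, and `Φ = 0` forces `𝔙 = 0` by the dimension bound).
[cite: Nesterenko2003, §5.2 Lemma 5.2, p. 98] -/
theorem sigma_mem_toSubgroup_imp {n : ℕ} (ξ : Fin n → ℂˣ)
    (hξ : ∀ φ : Fin n → ℤ, ∏ j, (ξ j) ^ (φ j) = 1 → φ = 0)
    (H : ConnAlgSubgroup n) {r : ℕ} (M : Matrix (Fin r) (Fin n) ℤ)
    (hM : LinearIndependent ℤ (fun i => M i))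
    (hchars : H.chars = AddSubgroup.closure (Set.range fun i => M i))
    (hdim : H.addDim + (n - r) ≤ n) (x : ℤ)
    (hx : ((Multiplicative.ofAdd (x : ℂ), fun j => ξ j ^ x) : GaGm n) ∈ H.toSubgroup) : x = 0 := by
  classical
  by_contra hx0
  obtain ⟨h1, h2⟩ := hx
  -- every character of `G*` is killed by `x ≠ 0`
  have hchi : ∀ χ ∈ H.chars, χ = 0 := fun χ hχ => by
    have h : ∏ j, (ξ j ^ x) ^ (χ j) = 1 := h2 χ hχ
    have h' : ∏ j, ξ j ^ ((x • χ) j) = 1 := by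
      refine Eq.trans (Finset.prod_congr rfl fun j _ => ?_) h
      rw [Pi.smul_apply, smul_eq_mul, _root_.zpow_mul]
    have hxχ : x • χ = 0 := hξ (x • χ) h'
    exact (smul_eq_zero.mp hxχ).resolve_left hx0
  -- hence `r = 0`
  have hr : r = 0 := by
    rcases Nat.eq_zero_or_pos r with h | h
    · exact h
    · exfalso
      have hmem : M ⟨0, h⟩ ∈ H.chars := by
        rw [hchars]; exact AddSubgroup.subset_closure ⟨⟨0, h⟩, rfl⟩
      exact hM.ne_zero ⟨0, h⟩ (hchi _ hmem)
  subst hr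
  -- and `𝔙 = 0` by the dimension bound
  have hadd0 : H.addDim = 0 := by omega
  have hadd : H.addPart = false := by
    cases hP : H.addPart
    · rfl
    · simp [ConnAlgSubgroup.addDim, hP] at hadd0
  have hone : Multiplicative.ofAdd (x : ℂ) = 1 := h1 hadd
  have hx' : (x : ℂ) = 0 := by
    have h := congrArg Multiplicative.toAdd hone
    simpa using h
  exact hx0 (by exact_mod_cast hx')

/-- **`Card((Σ·G*)/G*) = Card Σ = 2X + 1`** for `Σ = {(x, ξˣ) ; |x| ≤ X}` (Lemma 5.2 ⇒ the classes
of `Σ` modulo `G*` are distinct). [cite: Nesterenko2003, §5.2 Lemma 5.2 and (5.12), pp. 98–99] -/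
theorem ncard_image_mk_sigma {n : ℕ} (ξ : Fin n → ℂˣ)
    (hξ : ∀ φ : Fin n → ℤ, ∏ j, (ξ j) ^ (φ j) = 1 → φ = 0)
    (X : ℕ) (S : Set (GaGm n))
    (hS : ∀ g, g ∈ S ↔ ∃ x : ℤ, |x| ≤ X ∧ g = (Multiplicative.ofAdd (x : ℂ), fun j => ξ j ^ x))
    (H : ConnAlgSubgroup n) {r : ℕ} (M : Matrix (Fin r) (Fin n) ℤ)
    (hM : LinearIndependent ℤ (fun i => M i))
    (hchars : H.chars = AddSubgroup.closure (Set.range fun i => M i))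
    (hdim : H.addDim + (n - r) ≤ n) :
    Set.ncard ((QuotientGroup.mk : GaGm n → GaGm n ⧸ H.toSubgroup) '' S) = 2 * X + 1 := by
  classical
  set σ : ℤ → GaGm n := fun x => (Multiplicative.ofAdd (x : ℂ), fun j => ξ j ^ x) with hσ
  have hσ_sub : ∀ x y : ℤ, (σ x)⁻¹ * σ y = σ (y - x) := fun x y => by
    ext j
    · change (Multiplicative.ofAdd (x : ℂ))⁻¹ * Multiplicative.ofAdd (y : ℂ) =
        Multiplicative.ofAdd ((y - x : ℤ) : ℂ)
      rw [← ofAdd_neg, ← ofAdd_add, Int.cast_sub, neg_add_eq_sub]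
    · simp [hσ, _root_.zpow_sub, div_eq_mul_inv, mul_comm]
  -- `x ↦ σ x · G*` is injective
  have hinj : Function.Injective
      (fun x : ℤ => (QuotientGroup.mk (σ x) : GaGm n ⧸ H.toSubgroup)) := by
    intro x y hxy
    have h : (σ x)⁻¹ * σ y ∈ H.toSubgroup := QuotientGroup.eq.mp hxy
    rw [hσ_sub] at h
    have h0 := sigma_mem_toSubgroup_imp ξ hξ H M hM hchars hdim (y - x) h
    omega
  -- `Σ = σ([-X, X])`
  have hSeq : S = σ '' Set.Icc (-(X : ℤ)) X := by
    ext g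
    rw [hS, Set.mem_image]
    constructor
    · rintro ⟨x, hx, rfl⟩
      exact ⟨x, Set.mem_Icc.mpr (abs_le.mp hx), rfl⟩
    · rintro ⟨x, hx, rfl⟩
      exact ⟨x, abs_le.mpr (Set.mem_Icc.mp hx), rfl⟩
  rw [hSeq, Set.image_image, Set.ncard_image_of_injective _ hinj, Set.ncard_eq_toFinset_card',
    Set.toFinset_Icc, Int.card_Icc]
  have h : (X : ℤ) + 1 - -(X : ℤ) = ((2 * X + 1 : ℕ) : ℤ) := by push_cast; ring
  rw [h, Int.toNat_natCast]

/-! ### The consumer -/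

/-- **Nesterenko's §5.2, structural END.** Given the zero estimate (`Nesterenko2003_prop51`,
hypothesis), multiplicatively independent `ξ ∈ (ℂˣ)ⁿ`, `b ∈ ℤⁿ ∖ 0`, the sets `Σ = {(x, ξˣ) ;
|x| ≤ X}` and `𝔚 = ℂ × b^⊥`, and a non-zero `Q` of multidegree `≤ (D₀, 2D₁, …, 2Dₙ)` vanishing to
order `> (n+1)S₀` along `𝔚` on `Σ[n+1]`: the obstruction group has character lattice `Φ` with a
basis `M` of `r` independent rows, `d₀ ≤ 1`, `d₀ + (n − r) ≤ n`, and either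
(A) `b ∉ span_ℚ Φ` and `binom(S₀ + (r+1−d₀), r+1−d₀)·(2X+1)·𝓗(G*) ≤ (n+1)! 2ⁿ D₀ ∏ Dⱼ`, or
(B/C) `k b = ∑ cᵢ Mᵢ` (`k ≠ 0`) and `binom(S₀ + (r−d₀), r−d₀)·(2X+1)·𝓗(G*) ≤ (n+1)! 2ⁿ D₀ ∏ Dⱼ`.
[cite: Nesterenko2003, §5.2 (5.13), Lemmas 5.2–5.4, pp. 98–101] -/
theorem zeroEnd (hZ : Nesterenko2003_prop51) {n : ℕ} (ξ : Fin n → ℂˣ)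
    (hξ : ∀ φ : Fin n → ℤ, ∏ j, (ξ j) ^ (φ j) = 1 → φ = 0)
    (X : ℕ) (S : Set (GaGm n))
    (hS : ∀ g, g ∈ S ↔ ∃ x : ℤ, |x| ≤ X ∧ g = (Multiplicative.ofAdd (x : ℂ), fun j => ξ j ^ x))
    (b : Fin n → ℤ) (hb : b ≠ 0)
    (W : Submodule ℂ (ℂ × (Fin n → ℂ))) (hW : ∀ w, w ∈ W ↔ ∑ j, (b j : ℂ) * w.2 j = 0)
    (D₀ S₀ : ℕ) (D : Fin n → ℕ) (Q : MvPolynomial (Fin (n + 1)) ℂ) (hQ : Q ≠ 0)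
    (hdeg₀ : Q.degreeOf 0 ≤ D₀) (hdeg : ∀ j : Fin n, Q.degreeOf j.succ ≤ 2 * D j)
    (hvan : ∀ g ∈ sumset S (n + 1), VanishesToOrder Q W g ((n + 1) * S₀ + 1)) :
    ∃ (d₀ r : ℕ) (M : Matrix (Fin r) (Fin n) ℤ),
      d₀ ≤ 1 ∧ LinearIndependent ℤ (fun i => M i) ∧ d₀ + (n - r) ≤ n ∧
      (((¬ ∃ (k : ℤ) (c : Fin r → ℤ), k ≠ 0 ∧ k • b = ∑ i, c i • M i) ∧
          Nat.choose (S₀ + (r + 1 - d₀)) (r + 1 - d₀) * (2 * X + 1) * nesterenkoH n r d₀ M D₀ D ≤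
            (n + 1).factorial * 2 ^ n * D₀ * ∏ j, D j) ∨
        ((∃ (k : ℤ) (c : Fin r → ℤ), k ≠ 0 ∧ k • b = ∑ i, c i • M i) ∧
          Nat.choose (S₀ + (r - d₀)) (r - d₀) * (2 * X + 1) * nesterenkoH n r d₀ M D₀ D ≤
            (n + 1).factorial * 2 ^ n * D₀ * ∏ j, D j)) := by
  classical
  -- `Σ` is finite and contains `e`
  set σ : ℤ → GaGm n := fun x => (Multiplicative.ofAdd (x : ℂ), fun j => ξ j ^ x) with hσ
  have hSeq : S = σ '' Set.Icc (-(X : ℤ)) X := by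
    ext g
    rw [hS, Set.mem_image]
    constructor
    · rintro ⟨x, hx, rfl⟩
      exact ⟨x, Set.mem_Icc.mpr (abs_le.mp hx), rfl⟩
    · rintro ⟨x, hx, rfl⟩
      exact ⟨x, abs_le.mpr (Set.mem_Icc.mp hx), rfl⟩
  have hSfin : S.Finite := by rw [hSeq]; exact (Set.finite_Icc _ _).image σ
  have h1S : (1 : GaGm n) ∈ S := by
    rw [hS]
    refine ⟨0, by simp, ?_⟩
    ext j <;> simp
  -- the zero estimate
  obtain ⟨H, r, M, hMli, hchars, hdim, hineq⟩ := hZ n D₀ S₀ D W S Q hSfin h1S hQ hdeg₀ hdeg hvan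
  refine ⟨H.addDim, r, M, ?_, hMli, hdim, ?_⟩
  · cases hP : H.addPart <;> simp [ConnAlgSubgroup.addDim, hP]
  · rw [ncard_image_mk_sigma ξ hξ X S hS H M hMli hchars hdim] at hineq
    obtain ⟨hspan, hnspan⟩ := ell0_add_addDim_eq b hb W hW H M hMli hchars
    by_cases hex : ∃ (k : ℤ) (c : Fin r → ℤ), k ≠ 0 ∧ k • b = ∑ i, c i • M i
    · right
      refine ⟨hex, ?_⟩
      have hℓ : Module.finrank ℂ W - Module.finrank ℂ ↥(W ⊓ H.tangent) = r - H.addDim := by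
        have h := hspan hex; omega
      rw [hℓ] at hineq
      exact hineq
    · left
      refine ⟨hex, ?_⟩
      have hℓ : Module.finrank ℂ W - Module.finrank ℂ ↥(W ⊓ H.tangent) = r + 1 - H.addDim := by
        have h := hnspan hex; omega
      rw [hℓ] at hineq
      exact hineq

open scoped Classical in
/-- **Exit C with the lever.** In the situation of `zeroEnd`, if `k b = ∑ cᵢ Mᵢ` (`k ≠ 0`), then
for any weights `Aⱼ > 0` there are `ℤ`-independent `z₁, …, z_r ∈ Φ`, `m₀ ≠ 0`, `m`, `J` with
`m₀ b = ∑ mᵢ zᵢ`, `∏ᵢ ‖zᵢ‖_A ≤ 2^r (Γ(r/2+1)/√π^r) √n^r ∑_t |det M_t| ∏_k A_{t k}` and the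
Cramer–Hadamard bounds (2.11)/(2.12) — Prop. 2.6's data ((2.13) with (5.21)).
[cite: Nesterenko2003, Prop 2.6 and §5.2 (5.19)–(5.21), pp. 57–58, 103] -/
theorem zeroEnd_lever {n r : ℕ} (hr : 0 < r) (A : Fin n → ℝ) (hA : ∀ j, 0 < A j)
    (M : Matrix (Fin r) (Fin n) ℤ) (hM : LinearIndependent ℤ (fun i => M i))
    (b : Fin n → ℤ) (k : ℤ) (hk : k ≠ 0) (c : Fin r → ℤ) (hbk : k • b = ∑ i, c i • M i) :
    ∃ (z : Fin r → (Fin n → ℤ)) (m₀ : ℤ) (m : Fin r → ℤ) (J : Finset (Fin n)),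
      (∀ i, z i ∈ Submodule.span ℤ (Set.range fun i => M i)) ∧
      LinearIndependent ℤ z ∧ m₀ ≠ 0 ∧ m₀ • b = ∑ i, m i • z i ∧ J.card = r ∧
      (∏ i, ∑ j, A j * |(z i j : ℝ)|) ≤
        2 ^ r * (Real.Gamma ((r : ℝ) / 2 + 1) / Real.sqrt Real.pi ^ r) *
          (Real.sqrt n ^ r *
            ∑ t ∈ (univ : Finset (Fin r → Fin n)).filter (fun t => StrictMono t),
              |(Matrix.of fun i k => (M i (t k) : ℝ)).det| * ∏ k, A (t k)) ∧
      |(m₀ : ℝ)| * ∏ j ∈ J, A j ≤ ∏ i, ∑ j, A j * |(z i j : ℝ)| ∧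
      ∀ i, |(m i : ℝ)| * ∏ j ∈ J, A j ≤
        (∑ j ∈ J, |(b j : ℝ)| * A j) * ∏ i' ∈ univ.erase i, ∑ j, A j * |(z i' j : ℝ)| :=
  MatveevLever.exists_short_relation_minors hr A hA (fun i => M i) hM b k hk c hbk

end Summit.ABC.StewartYu.ZeroEnd

end
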